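import Summits.QuantumFields.YangMills.Theorems.VirialFluxGapCentralValleyLocalise
import Summits.QuantumFields.YangMills.Theorems.VirialFluxGapFixChart
import HarnessLib

/-!
# Route `VirialFluxGap` (YangMills): the CENTRAL twin of the `X_fix` chart — dichotomy, central comb point, logarithmic coordinates

Geometric input for the CENTRAL charts (C1∕C4, w3) and the patching of the ⟨stmt-QuantumFields-24141⟩ `PeriodicSoftness` Euler field on the
host `X_fix` (LEAD ruling 2026-08-30T23:30Z), complementing the regular chart ✓∕⧗`FixFrame.exists_fixChart_of_regular`:

* `regular_or_central` — every ring history is either `ρ`-REGULAR (some wrap representative of slice `0` or the seam value `P.2 0` has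
  `1 − Re² ≥ ρ²`) or `ρ`-CENTRAL (all four have `1 − Re² < ρ²`): the case split of the patching;
* ★ `exists_central_comb_near_of_central_of_treeGauge_eq_one` — at a `ρ`-central `P` in comb gauge (every `X_fix` point) there are signs
  `s : Fin 3 → Bool`, `b : Bool` such that the CENTRAL comb point `c_{s,b} = ((fun _ => combFlat (centreElem ∘ s)), fun _ => centreElem b)` is flat
  and per-variable close: `fd ≤ 4L√F₀ + 12L²√F₀ + 4ρ` (slices), `12L²√F₀ + 4ρ` (seam) — ✓`exists_central_flat_ring_near_of_central` at `t = 1`;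
* ★★ `exists_fixCentralChart_of_central` — if moreover `4L√F₀ + 12L²√F₀ + 4ρ < 1/4`, then `P = c_{s,b}·exp(dirOf fixFrameStd u)` with
  coordinates `u : FixVar L × Fin 3 → ℝ` in the standard `X_fix` frame and
  `|u|² ≤ 48·(2L·3L³·(4L√F₀+12L²√F₀+4ρ)² + L³·(12L²√F₀+4ρ)²)` (fcl-p3's ✓`exists_multiCurve_eq_of_near` from the base `c_{s,b}`; the logarithm
  vanishes on the tree links of slice `0`, where both are `1`; ✓`dirOf_fixFrameStd_fixCoord`, ✓`fixCoord_dot_self_le`).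

HONEST FRAMING: glue between landed files; the central charts themselves (zero-mode field, weights ½, LEAD's ✓`CombConstantDeficit`) and
the patching are NOT here; ⟨24141⟩ and ⟨22884⟩ stay OPEN; no stub ∕ crux ∕ rung ∕ summit is closed; the Yang–Mills mass gap is NOT proved; no summit is
proved by a line.  No definitions, 0 `sorry`, standard axioms.  Width seat `ym-line-sfw-p2-w2` g51 (cell ym-idea-1, free hands),
`--supports stmt-QuantumFields-24141`.  References: [cite: Luscher1983, §2] (torons), [folklore].
-/

set_option autoImplicit false

noncomputable section

open scoped Quaternion Matrix BigOperators
open Literature.MathematicalPhysics.QuantumFieldTheory hiding SU2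
open Literature.MathematicalPhysics.QuantumLattice

namespace Summit.QuantumFields.YangMills.Theorems.VirialFluxGap.FixFrame

open Summit.QuantumFields.YangMills.Theorems.FemtoTransferGap
open Summit.QuantumFields.YangMills.Theorems.FemtoTransferGap.TT
open Summit.QuantumFields.YangMills.Theorems.FemtoTransferGap.TwoLattice
open Summit.QuantumFields.YangMills.Theorems.FemtoTransferGap.TwoLattice.Flat
open Summit.QuantumFields.YangMills.Theorems.VirialFluxGap.RingDeficit
open Summit.QuantumFields.YangMills.Theorems.VirialFluxGap.FrameDerivative
open Summit.QuantumFields.YangMills.Theorems.VirialFluxGap.FrameHessian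
open Summit.QuantumFields.YangMills.Theorems.VirialFluxGap.RegularValley
open Summit.QuantumFields.YangMills.Theorems.ToronValleyVolume.Lojasiewicz

open scoped Matrix.Norms.Frobenius

variable {L : ℕ} [NeZero L]

omit [NeZero L] in
/-- The case split of the patching: every ring history is `ρ`-regular or `ρ`-central. [folklore] -/
theorem regular_or_central (P : (Fin (2 * L - 1 + 1) → GaugeConfig 3 L SU2) × (Site 3 L → SU2)) (ρ : ℝ) :
    ((∃ k : Fin 3, ρ ^ 2 ≤ 1 - (su2Quat (wrapReps (P.1 0) k)).re ^ 2) ∨ ρ ^ 2 ≤ 1 - (su2Quat (P.2 0)).re ^ 2) ∨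
      ((∀ k : Fin 3, 1 - (su2Quat (wrapReps (P.1 0) k)).re ^ 2 < ρ ^ 2) ∧ 1 - (su2Quat (P.2 0)).re ^ 2 < ρ ^ 2) := by
  by_cases h : (∃ k : Fin 3, ρ ^ 2 ≤ 1 - (su2Quat (wrapReps (P.1 0) k)).re ^ 2) ∨ ρ ^ 2 ≤ 1 - (su2Quat (P.2 0)).re ^ 2
  · exact Or.inl h
  · refine Or.inr ⟨fun k => ?_, ?_⟩
    · exact lt_of_not_ge fun hk => h (Or.inl ⟨k, hk⟩)
    · exact lt_of_not_ge fun hs => h (Or.inr hs)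

/-- ★ **The central comb point of a central ring history in comb gauge.**  `P` with `treeGauge (P.1 0) = 1` (every `X_fix` point) and
`ρ`-central (`0 ≤ ρ`): signs `s, b` with the central comb point flat and per-variable close. [cite: Luscher1983, §2] -/
theorem exists_central_comb_near_of_central_of_treeGauge_eq_one (P : (Fin (2 * L - 1 + 1) → GaugeConfig 3 L SU2) × (Site 3 L → SU2))
    (ht : treeGauge (P.1 0) = 1) {ρ : ℝ} (hρ : 0 ≤ ρ)
    (hcenW : ∀ k : Fin 3, 1 - (su2Quat (wrapReps (P.1 0) k)).re ^ 2 ≤ ρ ^ 2) (hcenS : 1 - (su2Quat (P.2 0)).re ^ 2 ≤ ρ ^ 2) :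
    ∃ (s : Fin 3 → Bool) (b : Bool),
      ringDeficit L (fun _ => false)
        (((fun _ => combFlat fun k => centreElem (s k)), fun _ => centreElem b) : (Fin (2 * L - 1 + 1) → GaugeConfig 3 L SU2) × (Site 3 L → SU2)) = 0 ∧
      (∀ (i : Fin (2 * L - 1 + 1)) (e : Edge 3 L), fd (P.1 i e) (combFlat (fun k => centreElem (s k)) e) ≤
        4 * (L : ℝ) * Real.sqrt (ringDeficit L (fun _ => false) P) + 12 * (L : ℝ) ^ 2 * Real.sqrt (ringDeficit L (fun _ => false) P) + 4 * ρ) ∧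
      (∀ x : Site 3 L, fd (P.2 x) (centreElem b) ≤ 12 * (L : ℝ) ^ 2 * Real.sqrt (ringDeficit L (fun _ => false) P) + 4 * ρ) := by
  obtain ⟨s, b, h0, h1, h2⟩ := exists_central_flat_ring_near_of_central P hρ hcenW hcenS
  have e1 : (fun _ : Fin (2 * L - 1 + 1) => gaugeTransform (treeGauge (P.1 0))⁻¹ (combFlat fun k => centreElem (s k))) =
      fun _ => (combFlat (fun k => centreElem (s k)) : GaugeConfig 3 L SU2) := by
    funext i
    rw [ht, inv_one, TT.gaugeTransform_one']
  refine ⟨s, b, ?_, fun i e => ?_, h2⟩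
  · rw [e1] at h0
    exact h0
  · have h := h1 i e
    rwa [ht, inv_one, TT.gaugeTransform_one'] at h

/-- ★★ **The central chart of `X_fix`**: a `ρ`-central `P` with slice-`0` tree links `= 1` and `4L√F₀ + 12L²√F₀ + 4ρ < 1/4` is a multi-direction
translate of its central comb point, `P = c_{s,b}·exp(dirOf fixFrameStd u)`, with
`|u|² ≤ 48·(2L·3L³·(4L√F₀+12L²√F₀+4ρ)² + L³·(12L²√F₀+4ρ)²)`. [cite: Luscher1983, §2] -/
theorem exists_fixCentralChart_of_central (P : (Fin (2 * L - 1 + 1) → GaugeConfig 3 L SU2) × (Site 3 L → SU2))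
    (hP : ∀ e : Edge 3 L, treeEdge e = true → P.1 0 e = 1) {ρ : ℝ} (hρ : 0 ≤ ρ)
    (hcenW : ∀ k : Fin 3, 1 - (su2Quat (wrapReps (P.1 0) k)).re ^ 2 ≤ ρ ^ 2) (hcenS : 1 - (su2Quat (P.2 0)).re ^ 2 ≤ ρ ^ 2)
    (hsmall : 4 * (L : ℝ) * Real.sqrt (ringDeficit L (fun _ => false) P) + 12 * (L : ℝ) ^ 2 * Real.sqrt (ringDeficit L (fun _ => false) P) +
      4 * ρ < 1 / 4) :
    ∃ (s : Fin 3 → Bool) (b : Bool) (u : FixVar L × Fin 3 → ℝ),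
      ringDeficit L (fun _ => false)
        (((fun _ => combFlat fun k => centreElem (s k)), fun _ => centreElem b) : (Fin (2 * L - 1 + 1) → GaugeConfig 3 L SU2) × (Site 3 L → SU2)) = 0 ∧
      (((fun _ => combFlat fun k => centreElem (s k)), fun _ => centreElem b) : (Fin (2 * L - 1 + 1) → GaugeConfig 3 L SU2) × (Site 3 L → SU2)) *
          multiCurve (dirOf (fixFrameStd (L := L)) u) (dirOf_conjTranspose fixFrameStd_conjTranspose u) (dirOf_trace fixFrameStd_trace u) 1 = P ∧
      u ⬝ᵥ u ≤ 48 * (2 * (L : ℝ) * (3 * (L : ℝ) ^ 3) *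
          (4 * (L : ℝ) * Real.sqrt (ringDeficit L (fun _ => false) P) + 12 * (L : ℝ) ^ 2 * Real.sqrt (ringDeficit L (fun _ => false) P) + 4 * ρ) ^ 2 +
        (L : ℝ) ^ 3 * (12 * (L : ℝ) ^ 2 * Real.sqrt (ringDeficit L (fun _ => false) P) + 4 * ρ) ^ 2) := by
  set δ := Real.sqrt (ringDeficit L (fun _ => false) P) with hδ
  have hδ0 : 0 ≤ δ := Real.sqrt_nonneg _
  have hL1 : (1 : ℝ) ≤ L := by exact_mod_cast NeZero.one_le
  have ht : treeGauge (P.1 0) = 1 := treeGauge_eq_one_of_tree_links hP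
  obtain ⟨s, b, hC0, hC1, hC2⟩ := exists_central_comb_near_of_central_of_treeGauge_eq_one P ht hρ hcenW hcenS
  set B₁ := 4 * (L : ℝ) * δ + 12 * (L : ℝ) ^ 2 * δ + 4 * ρ with hB₁
  set B₂ := 12 * (L : ℝ) ^ 2 * δ + 4 * ρ with hB₂
  have hB₂₁ : B₂ ≤ B₁ := by rw [hB₁, hB₂]; nlinarith
  set C : (Fin (2 * L - 1 + 1) → GaugeConfig 3 L SU2) × (Site 3 L → SU2) := ((fun _ => combFlat fun k => centreElem (s k)), fun _ => centreElem b)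
    with hC
  -- the slots of `P` are `1/4`-close to those of `C`
  have hC1' : ∀ (i : Fin (2 * L - 1 + 1)) (e : Edge 3 L), fd (C.1 i e) (P.1 i e) ≤ B₁ := fun i e => by
    rw [fd_comm]; exact hC1 i e
  have hC2' : ∀ x : Site 3 L, fd (C.2 x) (P.2 x) ≤ B₂ := fun x => by rw [fd_comm]; exact hC2 x
  have hnear1 : ∀ (i : Fin (2 * L - 1 + 1)) (e : Edge 3 L),
      ‖(P.1 i e : Matrix (Fin 2) (Fin 2) ℂ) - (C.1 i e : Matrix (Fin 2) (Fin 2) ℂ)‖ < 1 / 4 := fun i e => by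
    rw [norm_coe_sub_coe_eq_fd]
    exact (hC1' i e).trans_lt hsmall
  have hnear2 : ∀ x : Site 3 L, ‖(P.2 x : Matrix (Fin 2) (Fin 2) ℂ) - (C.2 x : Matrix (Fin 2) (Fin 2) ℂ)‖ < 1 / 4 := fun x => by
    rw [norm_coe_sub_coe_eq_fd]
    exact (hC2' x).trans_lt (hB₂₁.trans_lt hsmall)
  obtain ⟨Y, hY, hY0, hCP, hY1, hY2⟩ := exists_multiCurve_eq_of_near C P hnear1 hnear2
  -- `Y` vanishes on the tree links of slice `0`
  have hYtree : ∀ e : Edge 3 L, treeEdge e = true → Y (Sum.inl (0, e)) = 0 := fun e he => by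
    have h := hY1 0 e
    have hCe : C.1 0 e = 1 := by
      show combFlat (fun k => centreElem (s k)) e = 1
      rw [combFlat_apply, if_neg (fun h => not_treeEdge_of_wrap h he)]
    rw [hCe, hP e he, sub_self, norm_zero, mul_zero] at h
    exact norm_le_zero_iff.1 h
  refine ⟨s, b, fixCoord Y, hC0, ?_, ?_⟩
  · rw [multiCurve_congr _ _ hY hY0 (dirOf_fixFrameStd_fixCoord hY hY0 hYtree) 1]
    exact hCP
  · have hcardI : (Fintype.card (Fin (2 * L - 1 + 1)) : ℝ) = 2 * (L : ℝ) := by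
      rw [Fintype.card_fin]
      have hL : 1 ≤ L := NeZero.one_le
      rw [show 2 * L - 1 + 1 = 2 * L by omega]; push_cast; ring
    have hcardS : (Fintype.card (Site 3 L) : ℝ) = (L : ℝ) ^ 3 := by
      rw [Fintype.card_pi, Finset.prod_const, Finset.card_univ, Fintype.card_fin, ZMod.card]; push_cast; ring
    have hY1' : ∀ (i : Fin (2 * L - 1 + 1)) (e : Edge 3 L), ‖Y (Sum.inl (i, e))‖ ≤ 2 * fd (C.1 i e) (P.1 i e) := fun i e => by
      have h := hY1 i e
      rw [norm_coe_sub_coe_eq_fd] at h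
      exact h
    have hY2' : ∀ x : Site 3 L, ‖Y (Sum.inr x)‖ ≤ 2 * fd (C.2 x) (P.2 x) := fun x => by
      have h := hY2 x
      rw [norm_coe_sub_coe_eq_fd] at h
      exact h
    have hs1 : ∀ (i : Fin (2 * L - 1 + 1)) (e : Edge 3 L), ‖Y (Sum.inl (i, e))‖ ^ 2 ≤ 4 * B₁ ^ 2 := fun i e => by
      have h2 : ‖Y (Sum.inl (i, e))‖ ≤ 2 * B₁ := (hY1' i e).trans (by linarith [hC1' i e])
      calc ‖Y (Sum.inl (i, e))‖ ^ 2 ≤ (2 * B₁) ^ 2 := pow_le_pow_left₀ (norm_nonneg _) h2 2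
        _ = 4 * B₁ ^ 2 := by ring
    have hs2 : ∀ x : Site 3 L, ‖Y (Sum.inr x)‖ ^ 2 ≤ 4 * B₂ ^ 2 := fun x => by
      have h2 : ‖Y (Sum.inr x)‖ ≤ 2 * B₂ := (hY2' x).trans (by linarith [hC2' x])
      calc ‖Y (Sum.inr x)‖ ^ 2 ≤ (2 * B₂) ^ 2 := pow_le_pow_left₀ (norm_nonneg _) h2 2
        _ = 4 * B₂ ^ 2 := by ring
    have hA : (∑ i : Fin (2 * L - 1 + 1), ∑ e : Edge 3 L, ‖Y (Sum.inl (i, e))‖ ^ 2) ≤ 2 * (L : ℝ) * (3 * (L : ℝ) ^ 3 * (4 * B₁ ^ 2)) := by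
      have hin : ∀ i : Fin (2 * L - 1 + 1), ∑ e : Edge 3 L, ‖Y (Sum.inl (i, e))‖ ^ 2 ≤ 3 * (L : ℝ) ^ 3 * (4 * B₁ ^ 2) := fun i =>
        calc ∑ e : Edge 3 L, ‖Y (Sum.inl (i, e))‖ ^ 2 ≤ ∑ _e : Edge 3 L, 4 * B₁ ^ 2 := Finset.sum_le_sum fun e _ => hs1 i e
          _ = 3 * (L : ℝ) ^ 3 * (4 * B₁ ^ 2) := by rw [Finset.sum_const, Finset.card_univ, nsmul_eq_mul, ConstTube.card_edge_three L]
      calc (∑ i : Fin (2 * L - 1 + 1), ∑ e : Edge 3 L, ‖Y (Sum.inl (i, e))‖ ^ 2) ≤ ∑ _i : Fin (2 * L - 1 + 1), 3 * (L : ℝ) ^ 3 * (4 * B₁ ^ 2) :=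
            Finset.sum_le_sum fun i _ => hin i
        _ = 2 * (L : ℝ) * (3 * (L : ℝ) ^ 3 * (4 * B₁ ^ 2)) := by rw [Finset.sum_const, Finset.card_univ, nsmul_eq_mul, hcardI]
    have hB : ∑ x : Site 3 L, ‖Y (Sum.inr x)‖ ^ 2 ≤ (L : ℝ) ^ 3 * (4 * B₂ ^ 2) := by
      calc ∑ x : Site 3 L, ‖Y (Sum.inr x)‖ ^ 2 ≤ ∑ _x : Site 3 L, 4 * B₂ ^ 2 := Finset.sum_le_sum fun x _ => hs2 x
        _ = (L : ℝ) ^ 3 * (4 * B₂ ^ 2) := by rw [Finset.sum_const, Finset.card_univ, nsmul_eq_mul, hcardS]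
    have hsplit : ∑ w : ((Fin (2 * L - 1 + 1) × Edge 3 L) ⊕ Site 3 L), ‖Y w‖ ^ 2 =
        (∑ i : Fin (2 * L - 1 + 1), ∑ e : Edge 3 L, ‖Y (Sum.inl (i, e))‖ ^ 2) + ∑ x : Site 3 L, ‖Y (Sum.inr x)‖ ^ 2 := by
      rw [Fintype.sum_sum_type, Fintype.sum_prod_type]
    have hu := fixCoord_dot_self_le (L := L) Y
    rw [hsplit] at hu
    calc fixCoord (L := L) Y ⬝ᵥ fixCoord (L := L) Y
        ≤ 12 * ((∑ i : Fin (2 * L - 1 + 1), ∑ e : Edge 3 L, ‖Y (Sum.inl (i, e))‖ ^ 2) + ∑ x : Site 3 L, ‖Y (Sum.inr x)‖ ^ 2) := hu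
      _ ≤ 12 * (2 * (L : ℝ) * (3 * (L : ℝ) ^ 3 * (4 * B₁ ^ 2)) + (L : ℝ) ^ 3 * (4 * B₂ ^ 2)) := by linarith [hA, hB]
      _ = 48 * (2 * (L : ℝ) * (3 * (L : ℝ) ^ 3) * B₁ ^ 2 + (L : ℝ) ^ 3 * B₂ ^ 2) := by ring

end Summit.QuantumFields.YangMills.Theorems.VirialFluxGap.FixFrame

end
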